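import Summits.MatrixMultiplication.MatrixMultiplication.Theorems.AbelianSTPPCensusTALin1700Data3

/-!
# T_A/1700 certificate: kernel evaluation, volumes `936 … 1025`

Cell mm-stpp (rung F-M1), T_A/1700 = «no abelian STPP host of order `≤ 1700` beats `τ = 2.371`»; checker in `AbelianSTPPCensusTALin1700Defs.lean`,
checkpoint states in `…TALin1700Data1/2/3.lean`.  `decide` with kernel reduction (standard axioms; no `native_decide`); at most `150` sorted
candidate shapes per segment (× 500 orders) and `Elab.async false` — the safe size at the gate (cf. the T_A/1200 chain).  Each segment
recomputes the next checkpoint from the previous one and checks every sorted candidate shape of its volumes at every order `1201 … 1700`; consumed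
by `TALin1700.seg_sound` / `TALin1700.loopL_sound` in `AbelianSTPPCensusLeafTA1700Closed.lean`.
WHAT THIS IS NOT: arithmetic on shape lists only; no statement about STPP families or `ω`.
-/

set_option linter.dupNamespace false
set_option autoImplicit false
set_option Elab.async false

namespace Summit.MatrixMultiplication.MatrixMultiplication.Theorems.TALin1700

set_option maxHeartbeats 0 in
/-- Segment `936 … 959` (131 sorted shapes): from `st935` the loop reaches `st959`, all checks at orders `1201 … 1700` passing. [original] -/
theorem sg936 : loopL 1201 500 24 936 st935 = (true, st959) := by decide +kernel

set_option maxHeartbeats 0 in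
/-- Segment `960 … 979` (134 sorted shapes): from `st959` the loop reaches `st979`, all checks at orders `1201 … 1700` passing. [original] -/
theorem sg960 : loopL 1201 500 20 960 st959 = (true, st979) := by decide +kernel

set_option maxHeartbeats 0 in
/-- Segment `980 … 1005` (150 sorted shapes): from `st979` the loop reaches `st1005`, all checks at orders `1201 … 1700` passing. [original] -/
theorem sg980 : loopL 1201 500 26 980 st979 = (true, st1005) := by decide +kernel

set_option maxHeartbeats 0 in
/-- Segment `1006 … 1025` (136 sorted shapes): from `st1005` the loop reaches `st1025`, all checks at orders `1201 … 1700` passing. [original] -/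
theorem sg1006 : loopL 1201 500 20 1006 st1005 = (true, st1025) := by decide +kernel

end Summit.MatrixMultiplication.MatrixMultiplication.Theorems.TALin1700
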